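import Literature.NumberTheory.Sieve.QuadraticPhaseRecurrence

/-!
# Route `GreenTaoLevelTwo`, crux `MNTwo` (stmt-Parity-21276), line `birth`, stub `stub_mnVertical`:
# Weyl's inequality on the progressions of Corollary 20 (GT 2008b §10, last step of Lemma 23)

Tool for block V4 (= AIF §10) of the `stub_mnVertical` census (B. Green, T. Tao, *Quadratic
uniformity of the Möbius function*, Ann. Inst. Fourier 58 (2008) = arXiv:math/0606087, proof of
Lemma 23: "we may infer the existence of `α, β ∈ ℝ/ℤ` such that
`|𝔼_{1≤l≤L} e(½l(l−1)φ''(dt,dt) + αl + β)| ≳ 1` … Lemma (Weyl) applies and we may indeed conclude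
that `‖φ''(dt,dt)‖_{ℝ/ℤ,Q} ≲ L^{-2}`").  The phase produced by Cor. 20
(`…MNTwoLocalQuadratic.phase_on_progression`) is `(l choose 2)·θ + αl + β`; this file feeds it to
the tree's inverse Weyl inequality `QuadraticMoebius.exists_distInt_mul_le_of_norm_quadratic_sum_ge`
(`θ₂ = θ/2`, `θ₁ = α − θ/2`, the constant `e(β)` discarded) and doubles back from `kθ/2` to `kθ`.
Def-free:

* `weyl_choose_two_progression` — if `ηL ≤ ‖∑_{l=1}^{L} e((l choose 2)θ + αl + β)‖` then some
  `1 ≤ k ≤ C(8/η²)^A` has `‖kθ‖_{ℝ/ℤ} ≤ 2C(8/η²)^A/L²`.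

References: [GreenTao2008QuadraticMobius] arXiv:math/0606087 §10 (Lemma 23), App. A (Weyl).
-/

noncomputable section

open Finset Real
open scoped FourierTransform

namespace Summit.Parity.GeneralizedHardyLittlewood.GreenTaoLevelTwoMNTwoWeylProgression

open Literature.NumberTheory.Sieve.Vinogradov (distInt distInt_add_le)
open Literature.NumberTheory.Sieve.QuadraticMoebius (exists_distInt_mul_le_of_norm_quadratic_sum_ge)

/-- The Cor-20 phase is a genuine quadratic: `e((l choose 2)θ + αl + β) = e(β) e((θ/2)l² + (α−θ/2)l)`.
[folklore] -/
theorem fourierChar_choose_two (θ α β : ℝ) (l : ℕ) :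
    (𝐞 (((l.choose 2 : ℕ) : ℝ) * θ + α * l + β) : ℂ) =
      (𝐞 β : ℂ) * (𝐞 (θ / 2 * (l : ℝ) ^ 2 + (α - θ / 2) * l) : ℂ) := by
  rw [Real.fourierChar_apply, Real.fourierChar_apply, Real.fourierChar_apply, ← Complex.exp_add]
  congr 1
  rw [Nat.cast_choose_two]
  push_cast
  ring

/-- **Weyl's inequality on a Cor-20 progression.**  There are `A ∈ ℕ`, `C ≥ 1` such that: if
`0 < η ≤ 1`, `L ≥ 1` and `ηL ≤ ‖∑_{l=1}^{L} e((l choose 2)θ + αl + β)‖`, then some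
`1 ≤ k ≤ C(8/η²)^A` has `‖kθ‖_{ℝ/ℤ} ≤ 2C(8/η²)^A/L²`.
[cite: GreenTao2008QuadraticMobius, §10 (proof of Lemma 23) and App. A (Weyl's inequality)] -/
theorem weyl_choose_two_progression :
    ∃ (A : ℕ) (C : ℝ), 1 ≤ C ∧
      ∀ (η : ℝ) (L : ℕ) (θ α β : ℝ), 0 < η → η ≤ 1 → 1 ≤ L →
        η * L ≤ ‖∑ l ∈ Icc 1 L, (𝐞 (((l.choose 2 : ℕ) : ℝ) * θ + α * l + β) : ℂ)‖ →
        ∃ k : ℕ, 1 ≤ k ∧ (k : ℝ) ≤ C * (8 / η ^ 2) ^ A ∧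
          distInt (k * θ) ≤ 2 * (C * (8 / η ^ 2) ^ A / (L : ℝ) ^ 2) := by
  obtain ⟨A, C, hC1, hW⟩ := exists_distInt_mul_le_of_norm_quadratic_sum_ge
  refine ⟨A, C, hC1, fun η L θ α β hη hη1 hL hS => ?_⟩
  -- remove the constant `e(β)` and pass to `Ioc 0 (0 + L)`
  have hsum : ∑ l ∈ Icc 1 L, (𝐞 (((l.choose 2 : ℕ) : ℝ) * θ + α * l + β) : ℂ) =
      (𝐞 β : ℂ) * ∑ n ∈ Ioc 0 (0 + L), (𝐞 (θ / 2 * (n : ℝ) ^ 2 + (α - θ / 2) * n) : ℂ) := by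
    rw [zero_add, ← Finset.Icc_add_one_left_eq_Ioc, zero_add, Finset.mul_sum]
    exact Finset.sum_congr rfl fun l _ => fourierChar_choose_two θ α β l
  rw [hsum, norm_mul, Circle.norm_coe, one_mul] at hS
  obtain ⟨k, hk1, hkC, hdist⟩ := hW η 0 L (θ / 2) (α - θ / 2) hη hη1 hL hS
  refine ⟨k, hk1, hkC, ?_⟩
  have h2 : (k : ℝ) * θ = k * (θ / 2) + k * (θ / 2) := by ring
  rw [h2]
  exact (distInt_add_le _ _).trans (by linarith)

end Summit.Parity.GeneralizedHardyLittlewood.GreenTaoLevelTwoMNTwoWeylProgression
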